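import Summits.Ventures.LatticeQCDFlow.Exactness.Phi4HMCNoSpectralGap
import Summits.Ventures.LatticeQCDFlow.Exactness.Phi4HMCTailRejectionN
import HarnessLib

/-!
# HMC for lattice φ⁴ has NO SPECTRAL GAP at fixed step size — every trajectory length `N`

HONEST FRAMING: exact (Metropolis-corrected) sampling algorithms for lattice gauge theory;
figures of merit are autocorrelation/cost numbers at stated couplings and volumes; no
continuum-physics claim.  (SCALAR calibration rung S0-A: not a gauge result.)

Venture `LatticeQCDFlow` (cell pub-lqcd), topic `Exactness`; FANOUT row 2 (`s0-phi4`, HMC arm —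
row 2's actual HMC update `hmcOpPhi4 J λ δ N`, any number `N ≥ 1` of qpq leapfrog steps).  NEW WORK of
the cell, composing `Exactness/Phi4HMCTailRejectionN.lean` (from the far box the `N`-step update is
accepted with probability `≤ ε`) with the indicator Dirichlet-form bound and the box lemmas of
`Exactness/Phi4HMCNoSpectralGap.lean` / `Phi4HMCTailRejection.lean` (both already general in `N`).
Nothing is cited as a fact.  Printed counterpart NAMED ONLY: Livingstone–Betancourt–Byrne–Girolami,
Bernoulli 25 (2019) Thm 5.13 (HMC with fixed integration time on lighter-than-Gaussian targets is not
geometrically ergodic, under isotropic growth conditions that the lattice φ⁴ potential violates for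
`V ≥ 3`; corpus `paper:arxiv-1601.08057` p. 13) and Roberts–Tweedie 1996; the lattice statement with a
coordinatewise box and explicit constants is the cell's.

## What is proved (`Λ = Fin (n+1)`, every `N ≥ 1`, `λ > 0`, real `J`, `δ > 0`; `K = hmcOpPhi4 J λ δ N`;
`χ_t` the indicator of `A_t = {t ≤ φ_x ≤ 2t ∀x}`, `g_t = χ_t − ⟨χ_t⟩`)

* **`hmcPhi4_no_spectral_gap`** — for every `ε > 0` there is `t ≥ 1` with `∫ g_t² e^{−S} > 0` and
  `ρ_{g_t}(1) = ∫ g_t (K g_t) e^{−S} / ∫ g_t² e^{−S} ≥ 1 − ε`: NO `L²(e^{−S})` SPECTRAL GAP;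
* **`hmcPhi4_tauInt_unbounded`** — hence bounded observables with `τ_int ≥ 1/ε − ½` per trajectory
  (whenever their autocorrelation series is summable and `ρ(1) < 1`).

Reading (no numerics implied): row 2's exact HMC arm, at every fixed `(δ, N)`, has no uniform-in-
observable autocorrelation bound and no geometric `L²` convergence rate; the obstruction lives in
tail boxes of Gibbs mass `≤ ⟨φ₀²⟩/t²` (in truth `≈ e^{−λVt⁴}`) and says nothing about `τ_int(M)` at
simulated parameters — it is the certified reason uniform guarantees need adaptive / randomised step
sizes or a tail-stable integrator.  NOT CLAIMED: the pqp integrator; partial momentum refreshment;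
`λ = 0` (there the leapfrog is stable for `δ²Ω² < 4` and the statement is false).
-/

namespace Summit.Ventures.LatticeQCDFlow.Exactness

open Real MeasureTheory Filter Finset
open Summit.Ventures.LatticeQCDFlow.Scoring

section NoGapN

variable {n : ℕ}

/-- **HMC FOR LATTICE φ⁴ HAS NO SPECTRAL GAP, EVERY TRAJECTORY LENGTH.**  Every `N ≥ 1`, `λ > 0`,
every real `J`, every step size `δ > 0`; `K = hmcOpPhi4 J λ δ N` (refresh, `N` qpq leapfrog steps,
flip, Metropolis test).  For
every `ε > 0` there is `t ≥ 1` such that the centred indicator `g = χ_t − ⟨χ_t⟩` of the box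
`A_t = {t ≤ φ_x ≤ 2t ∀x}` is a non-trivial bounded observable (`∫ g² e^{−S} > 0`) with lag-one
autocorrelation `ρ_g(1) = ∫ g (K g) e^{−S} / ∫ g² e^{−S} ≥ 1 − ε`. -/
theorem hmcPhi4_no_spectral_gap {lam δ : ℝ} (hlam : 0 < lam) (hδ : 0 < δ)
    (J : Fin (n + 1) → Fin (n + 1) → ℝ) (N : ℕ) (hN : 1 ≤ N) {ε : ℝ} (hε : 0 < ε) :
    ∃ t : ℝ, 1 ≤ t ∧
      0 < ∫ φ, ((if (∀ x, t ≤ φ x ∧ φ x ≤ 2 * t) then (1 : ℝ) else 0)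
          - gibbsExpect J lam (fun ψ => if (∀ x, t ≤ ψ x ∧ ψ x ≤ 2 * t) then (1 : ℝ) else 0)) ^ 2
          * gibbsWeight J lam φ ∧
      1 - ε ≤ (∫ φ, ((if (∀ x, t ≤ φ x ∧ φ x ≤ 2 * t) then (1 : ℝ) else 0)
          - gibbsExpect J lam (fun ψ => if (∀ x, t ≤ ψ x ∧ ψ x ≤ 2 * t) then (1 : ℝ) else 0))
        * hmcOpPhi4 J lam δ N (fun ψ => (if (∀ x, t ≤ ψ x ∧ ψ x ≤ 2 * t) then (1 : ℝ) else 0)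
          - gibbsExpect J lam (fun ψ => if (∀ x, t ≤ ψ x ∧ ψ x ≤ 2 * t) then (1 : ℝ) else 0)) φ
        * gibbsWeight J lam φ)
        / ∫ φ, ((if (∀ x, t ≤ φ x ∧ φ x ≤ 2 * t) then (1 : ℝ) else 0)
          - gibbsExpect J lam (fun ψ => if (∀ x, t ≤ ψ x ∧ ψ x ≤ 2 * t) then (1 : ℝ) else 0)) ^ 2
          * gibbsWeight J lam φ := by
  have hco := latticePhi4Action_coercive hlam J
  have hZ := gibbsZ_pos hlam J
  -- second moment of `φ₀`, for Chebyshev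
  set M₂ := ∫ φ : Fin (n + 1) → ℝ, φ 0 ^ 2 * gibbsWeight J lam φ with hM₂
  have hM₂0 : 0 ≤ M₂ := integral_nonneg fun φ => mul_nonneg (sq_nonneg _) (gibbsWeight_pos J lam φ).le
  -- the tail-rejection scale, beyond `T₀ = 1 + 2 M₂/Z`
  obtain ⟨t, htT, ht1, hacc⟩ := hmcPhi4_accept_le_of_mem_box hlam hδ J N hN (half_pos hε)
    (1 + 2 * M₂ / gibbsZ J lam)
  have ht0 : 0 < t := by linarith
  refine ⟨t, ht1, ?_⟩
  set χ : (Fin (n + 1) → ℝ) → ℝ := fun φ => if (∀ x, t ≤ φ x ∧ φ x ≤ 2 * t) then (1 : ℝ) else 0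
    with hχdef
  have hχ : BddObs χ := boxInd_bddObs t
  have h01 : ∀ φ, χ φ = 0 ∨ χ φ = 1 := fun φ => by
    rw [hχdef]; dsimp only; split_ifs
    · exact Or.inr rfl
    · exact Or.inl rfl
  set a := gibbsExpect J lam χ with ha
  set I := ∫ φ, χ φ * gibbsWeight J lam φ with hI
  have hIpos : 0 < I := integral_boxInd_pos hlam J ht0
  have hIle : I ≤ 1 / t ^ 2 * M₂ := integral_boxInd_le hlam J ht0
  have haI : a * gibbsZ J lam = I := by
    rw [ha, hI]; unfold gibbsExpect; exact div_mul_cancel₀ _ hZ.ne'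
  have ha0 : 0 < a := by
    rw [ha]; unfold gibbsExpect; exact div_pos hIpos hZ
  -- `a ≤ ½` by Chebyshev and the choice of `T₀`
  have hahalf : a ≤ 1 / 2 := by
    have ht2 : 2 * M₂ / gibbsZ J lam ≤ t ^ 2 := by nlinarith
    have h1 : 2 * M₂ ≤ t ^ 2 * gibbsZ J lam := by
      rw [div_le_iff₀ hZ] at ht2; linarith
    have h2 : I * t ^ 2 ≤ M₂ := by
      have := hIle
      rw [one_div, ← div_eq_inv_mul, le_div_iff₀ (by positivity)] at this
      linarith
    have h3 : a * gibbsZ J lam * t ^ 2 ≤ M₂ := by rw [haI]; exact h2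
    have ht2pos : 0 < t ^ 2 := by positivity
    nlinarith [mul_pos hZ ht2pos]
  -- variance and Dirichlet form
  have hP : ∫ φ, (χ φ - a) ^ 2 * gibbsWeight J lam φ = (1 - a) * I :=
    integral_indicator_var hlam J hχ h01
  have hPpos : 0 < (1 - a) * I := mul_pos (by linarith) hIpos
  have hacc' : ∀ φ, χ φ = 1 →
      (∫ p, involAccept (phi4HmcEnergy J lam) (hmcProposal J lam δ N) (φ, p) * momentumWeight p)
          / momentumZ n ≤ ε / 2 := by
    intro φ hφ
    refine hacc φ ?_
    by_contra hnot
    have : χ φ = 0 := by rw [hχdef]; dsimp only; rw [if_neg hnot]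
    rw [this] at hφ
    exact zero_ne_one hφ
  have hdir := hmc_dirichlet_indicator_le hlam J δ N hχ h01 hacc' a
  refine ⟨by rw [hP]; exact hPpos, ?_⟩
  rw [hP] at hdir ⊢
  -- `ρ = C₁/P ≥ 1 − (ε/2) I/P = 1 − ε/(2(1 − a)) ≥ 1 − ε`
  rw [le_div_iff₀ hPpos]
  have h1a : 1 / 2 ≤ 1 - a := by linarith
  nlinarith [mul_nonneg hε.le hIpos.le]

/-- **Hence the integrated autocorrelation time is unbounded over bounded observables** (every
`N ≥ 1`): for every `ε > 0`, with `t` and `g = χ_t − ⟨χ_t⟩` as above, if the autocorrelation series of `g` is summable and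
`ρ_g(1) < 1` then `τ_int(g) ≥ 1/ε − ½` per update (Madras–Sokal floor of `ReversibleOperatorL2`). -/
theorem hmcPhi4_tauInt_unbounded {lam δ : ℝ} (hlam : 0 < lam) (hδ : 0 < δ)
    (J : Fin (n + 1) → Fin (n + 1) → ℝ) (N : ℕ) (hN : 1 ≤ N) {ε : ℝ} (hε : 0 < ε) :
    ∃ t : ℝ, 1 ≤ t ∧
      ((Summable fun k => (∫ φ, ((if (∀ x, t ≤ φ x ∧ φ x ≤ 2 * t) then (1 : ℝ) else 0)
          - gibbsExpect J lam (fun ψ => if (∀ x, t ≤ ψ x ∧ ψ x ≤ 2 * t) then (1 : ℝ) else 0))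
        * ((hmcOpPhi4 J lam δ N)^[k + 1] (fun ψ => (if (∀ x, t ≤ ψ x ∧ ψ x ≤ 2 * t) then (1 : ℝ) else 0)
          - gibbsExpect J lam (fun ψ => if (∀ x, t ≤ ψ x ∧ ψ x ≤ 2 * t) then (1 : ℝ) else 0))) φ
        * gibbsWeight J lam φ)
        / ∫ φ, ((if (∀ x, t ≤ φ x ∧ φ x ≤ 2 * t) then (1 : ℝ) else 0)
          - gibbsExpect J lam (fun ψ => if (∀ x, t ≤ ψ x ∧ ψ x ≤ 2 * t) then (1 : ℝ) else 0)) ^ 2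
          * gibbsWeight J lam φ) →
      (∫ φ, ((if (∀ x, t ≤ φ x ∧ φ x ≤ 2 * t) then (1 : ℝ) else 0)
          - gibbsExpect J lam (fun ψ => if (∀ x, t ≤ ψ x ∧ ψ x ≤ 2 * t) then (1 : ℝ) else 0))
        * hmcOpPhi4 J lam δ N (fun ψ => (if (∀ x, t ≤ ψ x ∧ ψ x ≤ 2 * t) then (1 : ℝ) else 0)
          - gibbsExpect J lam (fun ψ => if (∀ x, t ≤ ψ x ∧ ψ x ≤ 2 * t) then (1 : ℝ) else 0)) φ
        * gibbsWeight J lam φ)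
        / (∫ φ, ((if (∀ x, t ≤ φ x ∧ φ x ≤ 2 * t) then (1 : ℝ) else 0)
          - gibbsExpect J lam (fun ψ => if (∀ x, t ≤ ψ x ∧ ψ x ≤ 2 * t) then (1 : ℝ) else 0)) ^ 2
          * gibbsWeight J lam φ) < 1 →
      1 / ε - 1 / 2 ≤ tauInt (fun k => (∫ φ, ((if (∀ x, t ≤ φ x ∧ φ x ≤ 2 * t) then (1 : ℝ) else 0)
          - gibbsExpect J lam (fun ψ => if (∀ x, t ≤ ψ x ∧ ψ x ≤ 2 * t) then (1 : ℝ) else 0))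
        * ((hmcOpPhi4 J lam δ N)^[k] (fun ψ => (if (∀ x, t ≤ ψ x ∧ ψ x ≤ 2 * t) then (1 : ℝ) else 0)
          - gibbsExpect J lam (fun ψ => if (∀ x, t ≤ ψ x ∧ ψ x ≤ 2 * t) then (1 : ℝ) else 0))) φ
        * gibbsWeight J lam φ)
        / ∫ φ, ((if (∀ x, t ≤ φ x ∧ φ x ≤ 2 * t) then (1 : ℝ) else 0)
          - gibbsExpect J lam (fun ψ => if (∀ x, t ≤ ψ x ∧ ψ x ≤ 2 * t) then (1 : ℝ) else 0)) ^ 2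
          * gibbsWeight J lam φ)) := by
  have hco := latticePhi4Action_coercive hlam J
  obtain ⟨t, ht1, hP, hρ⟩ := hmcPhi4_no_spectral_gap hlam hδ J N hN hε
  refine ⟨t, ht1, fun hs hlt => ?_⟩
  have hΨm := measurable_hmcProposal J lam δ N (Λ := Fin (n + 1))
  have hΨi := hmcProposal_involutive J lam δ N (Λ := Fin (n + 1))
  have hΨμ : MeasurePreserving (hmcProposal J lam δ N)
      ((volume : Measure (Fin (n + 1) → ℝ)).prod volume)
      ((volume : Measure (Fin (n + 1) → ℝ)).prod volume) := measurePreserving_hmcProposal J lam δ N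
  obtain ⟨hθm, B, hθb⟩ := boxInd_bddObs (n := n) t
  obtain ⟨hgm, hgb, -⟩ := centred_observable hlam J hθm hθb
  have hg : BddObs (fun ψ : Fin (n + 1) → ℝ => (if (∀ x, t ≤ ψ x ∧ ψ x ≤ 2 * t) then (1 : ℝ) else 0)
      - gibbsExpect J lam (fun ψ => if (∀ x, t ≤ ψ x ∧ ψ x ≤ 2 * t) then (1 : ℝ) else 0)) :=
    ⟨hgm, _, hgb⟩
  have hfloor := RevOp.tauInt_ge (μ := volume) (A := BddObs)
    (K := hmcOpOf J lam (hmcProposal J lam δ N)) (w := gibbsWeight J lam)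
    (fun φ => (gibbsWeight_pos J lam φ).le)
    (fun f h hf hh => bddObs_integrable_mul_mul_gibbsWeight one_pos hco hf hh)
    (fun f h c hf hh => bddObs_add_mul hf hh c)
    (fun f hf => bddObs_hmcOpOf J lam hΨm hf)
    (fun f h c hf hh x => hmcOpOf_add_mul_bddObs J lam hΨm hf hh c x)
    (fun f h hf hh => hmcOpOf_reversible_bddObs one_pos hco hΨm hΨi hΨμ hf hh)
    (fun f hf => hmcOpOf_contraction_bddObs one_pos hco hΨm hΨi hΨμ hf) hg hs hlt
  refine le_trans ?_ hfloor
  -- `(1 + ρ)/(2(1 − ρ)) ≥ (2 − ε)/(2ε) = 1/ε − ½` for `1 − ε ≤ ρ < 1`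
  set r := (∫ φ, ((if (∀ x, t ≤ φ x ∧ φ x ≤ 2 * t) then (1 : ℝ) else 0)
          - gibbsExpect J lam (fun ψ => if (∀ x, t ≤ ψ x ∧ ψ x ≤ 2 * t) then (1 : ℝ) else 0))
        * hmcOpOf J lam (hmcProposal J lam δ N)
          (fun ψ => (if (∀ x, t ≤ ψ x ∧ ψ x ≤ 2 * t) then (1 : ℝ) else 0)
          - gibbsExpect J lam (fun ψ => if (∀ x, t ≤ ψ x ∧ ψ x ≤ 2 * t) then (1 : ℝ) else 0)) φ
        * gibbsWeight J lam φ)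
        / ∫ φ, ((if (∀ x, t ≤ φ x ∧ φ x ≤ 2 * t) then (1 : ℝ) else 0)
          - gibbsExpect J lam (fun ψ => if (∀ x, t ≤ ψ x ∧ ψ x ≤ 2 * t) then (1 : ℝ) else 0)) ^ 2
          * gibbsWeight J lam φ with hr
  have hρ' : 1 - ε ≤ r := hρ
  have hlt' : r < 1 := hlt
  rw [div_sub_div _ _ hε.ne' two_ne_zero, div_le_div_iff₀ (by positivity) (by linarith)]
  nlinarith

end NoGapN

end Summit.Ventures.LatticeQCDFlow.Exactness
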